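import Literature.Barriers.CriticalPhenomena.PlaquetteWalkDegenerateIdentity
import Literature.Barriers.CriticalPhenomena.PlaquetteWalkHoleRootDefect
import HarnessLib

/-!
# Barrier catalogue (SAWScalingLimit): the all-boundary-roots class of exact plaquette vertex relations
on `ℤ²`, classified on ALL of `ℂ⁵ × {t ≠ 0}`

Four tree theorems assembled:
* `PlaquetteWalkNoAllRootsRelation_holds` (`PlaquetteWalkHoleRootDefect`): for `u₁u₂v ≠ 0` no exact
  vertex relation with a nonzero constant coefficient vector survives the hole root of the `3 × 3` ring —
  the class is EMPTY there (all sixteen Yang–Baxter curves need the root on the outer boundary);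
* `PlaquetteWalkDegenerateClassification_holds` (`PlaquetteWalkDegenerateIdentity`): for `u₁u₂ ≠ 0`,
  `v = 0` a relation exists iff `t⁴ = 1` and the weights lie in Glazman's degenerate family
  `(u₁, −s − εt²u₁, 0, −εst²u₁, −s u₂)`, which then holds at every boundary root, hole roots included;
* `PlaquetteWalkCornerBranchClassification_holds` / `PlaquetteWalkMirrorBranchClassification_holds`
  (`PlaquetteWalkDegenerateIdentity`, appended section «corner slivers»): on the branch `u₁ = 0` (resp.
  `u₂ = 0`), for ALL other weights and every phase, a relation exists iff
  `(1+v−u₂)(1+v+u₂)(1−v−u₂)(1−v+u₂) = 0` (resp. the same quartic in `u₁`) — resting on the combinatorial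
  lemma `exists_kindsIn_eq_corner`: no Yang–Baxter walk doubles all its corner plaquettes.

Together: ★★ `exactPlaquetteVertexRelation_iff_allRoots` / named
`PlaquetteWalkAllRootsClassification(_holds)` — for every `W = (u₁, u₂, v, w₁, w₂) ∈ ℂ⁵` and every phase
`t ≠ 0`:
`(∃ c ≠ 0, ExactPlaquetteVertexRelation W t c) ↔ [u₁ ≠ 0 ∧ u₂ ≠ 0 ∧ v = 0 ∧ t⁴ = 1 ∧ W ∈ degenWeights]
∨ [u₁ = 0 ∧ (1+v−u₂)(1+v+u₂)(1−v−u₂)(1−v+u₂) = 0] ∨ [u₂ = 0 ∧ (1+v−u₁)(1+v+u₁)(1−v−u₁)(1−v+u₁) = 0]`.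
So the ONLY exact constant-coefficient vertex identities of the five-weight plaquette walk valid from
every boundary root of every finite domain are Glazman's integer-spin degenerate family and the
directed branches `u₁ = 0` / `u₂ = 0` on their quartics (statistical-mechanically trivial: turn weight
`u`, straight weight `v`, `(1 ± v)² = u²`, doubled-plaquette weights irrelevant); every other point of
`ℂ⁵` — in particular every point with `u₁u₂v ≠ 0`, all sixteen Yang–Baxter curves included — carries
none (`not_exists_exactPlaquetteVertexRelation_of_ne_zero`).

Sources: [cite: Glazman2015WeightedSAW, Lemma 3.1 (ECP 20 (2015) no. 86, pp. 5–7: "either v = 0 or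
σ = ℓ/8"; the σ = 1 family (3.8)–(3.10); "If v = 0, the solution exists for each θ if and only if
σ = 1")]; [cite: GlazmanManolescu2019, Lemma 2.1, §1 Fig. 1]; [cite: DuminilCopinSmirnov2012, Lemma 1];
[cite: IkhlefCardy2009, §3] (the printed outer-root classification with Cauchy–Riemann-shaped coefficients).
Status in print: the dichotomy is printed for the local rhombus system with Cauchy–Riemann-shaped
coefficients on parallelograms and outer roots; the typed all-roots classification on the whole weight
space (hole roots, arbitrary constant coefficients, complex weights, the branches `u₁ = 0` / `u₂ = 0`
with arbitrary doubled-plaquette weights) is the venture lane's («pcv-sawmu», Tier B, b-engine-1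
gen 12–13). Label of the lane's literature desk (2026-08-23): packaging = CONSOLIDATION of the four tree theorems;
the assembled all-roots statement on the whole of `ℂ⁵` = NEW-IN-WRITING (modest). Editions: ed.3 = this file's first
tree edition (proposal p376395, 2026-08-24; ed.2 + the `IkhlefCardy2009` token); the row-convex, interior-faces,
outer-root and quantifier classes on all of `ℂ⁵` are the lane's sequels (`PlaquetteWalkRowConvexClassification`,
`PlaquetteWalkInteriorFacesBranches`, `PlaquetteWalkOuterRootClassification`, `PlaquetteWalkDCSQuantifierClassification`),
which import this file.
-/

noncomputable section

namespace Literature.Barriers.CriticalPhenomena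

namespace PlaquetteWalk

open Literature.Probability.RandomPlanarGeometry.SAW.YangBaxter

/-- ★★ **The all-boundary-roots class, classified on all of `ℂ⁵ × {t ≠ 0}`**: for complex plaquette
weights `W` and any phase `t ≠ 0`, an exact plaquette vertex relation with some nonzero constant
coefficient vector at every face of every finite face list for every boundary root EXISTS iff either
`u₁u₂ ≠ 0`, `v = 0`, the spin is an integer (`t⁴ = 1`) and the weights belong to Glazman's degenerate
family, or `u₁ = 0` and `(1+v−u₂)(1+v+u₂)(1−v−u₂)(1−v+u₂) = 0`, or `u₂ = 0` and the same quartic in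
`u₁` vanishes. (`u₁u₂v ≠ 0`: empty — `PlaquetteWalkNoAllRootsRelation_holds`; `u₁u₂ ≠ 0`, `v = 0`:
`exactPlaquetteVertexRelation_iff_degen`; `u₁ = 0` / `u₂ = 0`:
`exactPlaquetteVertexRelation_iff_quartic_of_u₁_eq_zero` / `_of_u₂_eq_zero`.)
[cite: Glazman2015WeightedSAW, Lemma 3.1 (proof p. 7: "either v = 0 or σ = ℓ/8 … If v = 0, the solution exists for each θ if and only if σ = 1")] -/
theorem exactPlaquetteVertexRelation_iff_allRoots (W : CWeights) {t : ℂ} (ht : t ≠ 0) :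
    (∃ c : Fin 4 → ℂ, c ≠ 0 ∧ ExactPlaquetteVertexRelation W t c) ↔
      ((W.u₁ ≠ 0 ∧ W.u₂ ≠ 0 ∧ W.v = 0 ∧ t ^ 4 = 1 ∧
          ∃ ε s : ℂ, (ε = 1 ∨ ε = -1) ∧ (s = 1 ∨ s = -1) ∧ W = degenWeights ε s t W.u₁) ∨
        (W.u₁ = 0 ∧ (1 + W.v - W.u₂) * (1 + W.v + W.u₂) * (1 - W.v - W.u₂) * (1 - W.v + W.u₂) = 0) ∨
        (W.u₂ = 0 ∧ (1 + W.v - W.u₁) * (1 + W.v + W.u₁) * (1 - W.v - W.u₁) * (1 - W.v + W.u₁) = 0)) := by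
  by_cases h1 : W.u₁ = 0
  · rw [exactPlaquetteVertexRelation_iff_quartic_of_u₁_eq_zero W ht h1]
    constructor
    · intro hq
      exact Or.inr (Or.inl ⟨h1, hq⟩)
    · rintro (⟨h1', -⟩ | ⟨-, hq⟩ | ⟨h2, hq⟩)
      · exact (h1' h1).elim
      · exact hq
      · rw [h2]; rw [h1] at hq
        linear_combination hq
  · by_cases h2 : W.u₂ = 0
    · rw [exactPlaquetteVertexRelation_iff_quartic_of_u₂_eq_zero W ht h2]
      constructor
      · intro hq
        exact Or.inr (Or.inr ⟨h2, hq⟩)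
      · rintro (⟨-, h2', -⟩ | ⟨h1', -⟩ | ⟨-, hq⟩)
        · exact (h2' h2).elim
        · exact (h1 h1').elim
        · exact hq
    · by_cases hv : W.v = 0
      · rw [exactPlaquetteVertexRelation_iff_degen W ht h1 h2 hv]
        constructor
        · rintro ⟨ht4, hfam⟩
          exact Or.inl ⟨h1, h2, hv, ht4, hfam⟩
        · rintro (⟨-, -, -, ht4, hfam⟩ | ⟨h1', -⟩ | ⟨h2', -⟩)
          · exact ⟨ht4, hfam⟩
          · exact (h1 h1').elim
          · exact (h2 h2').elim
      · constructor
        · rintro ⟨c, hc, hrel⟩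
          exact (PlaquetteWalkNoAllRootsRelation_holds W t c ht h1 h2 hv hc hrel).elim
        · rintro (⟨-, -, hv', -⟩ | ⟨h1', -⟩ | ⟨h2', -⟩)
          · exact (hv hv').elim
          · exact (h1 h1').elim
          · exact (h2 h2').elim

/-- **Corollary: no point with `u₁u₂ ≠ 0` off the boundary `v = 0` and no non-integer spin carries an
all-roots relation** — restated from the classification: if `u₁ ≠ 0`, `u₂ ≠ 0` and (`v ≠ 0` or
`t⁴ ≠ 1`), the class is empty. In particular all sixteen Yang–Baxter integrable curves (`v ≠ 0`,
`t¹⁶ = −1`) carry their identities for OUTER roots only. [cite: Glazman2015WeightedSAW, Lemma 3.1 (pp. 5–7)] -/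
theorem not_exists_exactPlaquetteVertexRelation_of_ne_zero (W : CWeights) {t : ℂ} (ht : t ≠ 0)
    (h1 : W.u₁ ≠ 0) (h2 : W.u₂ ≠ 0) (hvt : W.v ≠ 0 ∨ t ^ 4 ≠ 1) :
    ¬∃ c : Fin 4 → ℂ, c ≠ 0 ∧ ExactPlaquetteVertexRelation W t c := by
  rw [exactPlaquetteVertexRelation_iff_allRoots W ht]
  rintro (⟨-, -, hv, ht4, -⟩ | ⟨h1', -⟩ | ⟨h2', -⟩)
  · rcases hvt with hv' | ht4'
    · exact hv' hv
    · exact ht4' ht4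
  · exact h1 h1'
  · exact h2 h2'

/-- **Barrier `PlaquetteWalkAllRootsClassification`** (named statement): the all-boundary-roots technique
class of the five-weight plaquette walk on `ℤ²` (constant coefficients, any complex weights, any phase
`t ≠ 0`) consists EXACTLY of Glazman's degenerate family at integer spin (`u₁u₂ ≠ 0`, `v = 0`, `t⁴ = 1`)
and the directed branches `u₁ = 0` / `u₂ = 0` on their quartics `(1 ± v)² = u²`. A THEOREM of this file
(`PlaquetteWalkAllRootsClassification_holds`).

BARRIER (structured block, D-0021):
- technique_class: plaquette-local linear vertex relations `Σ_{s ∈ (E,N,W,S)} c_s F(z_s) = 0` with a constant coefficient vector `c ∈ ℂ⁴ ∖ {0}` for the Glazman–Manolescu plaquette walk on `ℤ²` with complex weights `(u₁, u₂, v, w₁, w₂) ∈ ℂ⁵` and phase `t ≠ 0` per left quarter turn, demanded at every face of every finite face list for every boundary root (hole roots included) — `ExactPlaquetteVertexRelation W t c`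
- blocks: every such identity off the three families — in particular every identity with `u₁u₂v ≠ 0` (all sixteen Yang–Baxter curves, which carry identities for OUTER roots only) and every identity with `u₁u₂ ≠ 0` at non-integer spin; conversely it PROVIDES the identity on the degenerate lines at integer spin and on the branches `u₁ = 0` / `u₂ = 0` along their quartics at every phase, for every value of the doubled-plaquette weights
- because: `u₁u₂v ≠ 0` ⇒ empty (`PlaquetteWalkNoAllRootsRelation_holds`: rigidity puts the weights on a Yang–Baxter curve and the `3 × 3` ring rooted on its hole has loop form `2c_E r t⁵ v ≠ 0`); `u₁u₂ ≠ 0`, `v = 0` ⇒ `PlaquetteWalkDegenerateClassification_holds` (necessity `degenerate_rigidity`, sufficiency by last-arc grouping); `u₁ = 0` / `u₂ = 0` ⇒ `PlaquetteWalkCornerBranchClassification_holds` / `PlaquetteWalkMirrorBranchClassification_holds` (necessity = the four one-plaquette rows; sufficiency = no Yang–Baxter walk doubles all its corner plaquettes, `exists_kindsIn_eq_corner`, so only fresh arrivals contribute)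
- evasions_known: demand the relation at OUTER roots / on row-convex or hole-free face lists only (then the sixteen curves: `PlaquetteWalkYBClassificationAllSpins_holds`); non-constant or root-dependent coefficients (defect identities, `PlaquetteWalkIsthmusRoot`, `PlaquetteWalkIsthmusDefect`); other observables
- scope_caveats: EXACT constant-coefficient identities of the five-weight plaquette class only; nothing about other lattices or approximate relations; `t = 0` excluded
- status: established — `PlaquetteWalkAllRootsClassification_holds` (this file); print: [cite: Glazman2015WeightedSAW, Lemma 3.1 (pp. 5–7)] [cite: IkhlefCardy2009, §3] (dichotomy / holomorphicity fixing the integrable weights, for Cauchy–Riemann-shaped coefficients on parallelograms and OUTER roots) — the typed all-roots, arbitrary-coefficient classification on all of `ℂ⁵` is not located in print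
[cite: Glazman2015WeightedSAW, Lemma 3.1] -/
def _root_.Literature.Barriers.CriticalPhenomena.PlaquetteWalkAllRootsClassification : Prop :=
  ∀ (W : CWeights) (t : ℂ), t ≠ 0 →
    ((∃ c : Fin 4 → ℂ, c ≠ 0 ∧ ExactPlaquetteVertexRelation W t c) ↔
      ((W.u₁ ≠ 0 ∧ W.u₂ ≠ 0 ∧ W.v = 0 ∧ t ^ 4 = 1 ∧
          ∃ ε s : ℂ, (ε = 1 ∨ ε = -1) ∧ (s = 1 ∨ s = -1) ∧ W = degenWeights ε s t W.u₁) ∨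
        (W.u₁ = 0 ∧ (1 + W.v - W.u₂) * (1 + W.v + W.u₂) * (1 - W.v - W.u₂) * (1 - W.v + W.u₂) = 0) ∨
        (W.u₂ = 0 ∧ (1 + W.v - W.u₁) * (1 + W.v + W.u₁) * (1 - W.v - W.u₁) * (1 - W.v + W.u₁) = 0)))

/-- **`PlaquetteWalkAllRootsClassification` holds.** [cite: Glazman2015WeightedSAW, Lemma 3.1] -/
theorem _root_.Literature.Barriers.CriticalPhenomena.PlaquetteWalkAllRootsClassification_holds :
    PlaquetteWalkAllRootsClassification :=
  fun W _ ht => exactPlaquetteVertexRelation_iff_allRoots W ht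

end PlaquetteWalk

end Literature.Barriers.CriticalPhenomena
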